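import Mathlib
import Summits.NavierStokesRegularity.NavierStokesRegularity.Theorems.WakeRatchetTailRatchetTruncationLimit
import HarnessLib

/-!
# `WakeRatchet.TailRatchet` (stmt-NavierStokesRegularity-21808): the relative periodicity propagates the
# SHARP wake envelope — the wake of a one-period witness is geometric with the realised ratio

Support file for the crux `TailRatchet` (route `WakeRatchet`; MODEL lattice ODEs of Tao 2016 §4 —
nothing here is a statement about the Navier–Stokes equations).  The unrolling
`scalarFront_of_latticePeriod` needs the wake envelope `|Z_n| ≤ P (s/Λ)ⁿ` (`n < 0`) at the REALISED
flight time `s = 1 + T`; a fixed-point construction with a floating flight time in `[Tmin, Tmax]`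
naturally delivers only a WEAK geometric box (ratio taken at the worst end of the window), and
`latticePeriod_translate` then demands the box at `Tmax`, which real fronts violate far down the wake when
`T < Tmax`.  This file closes that gap once and for all, independently of the core analysis:

* `wake_envelope_of_matching` — matching `Z_{-j}(T) = c Z_{-j-1}(0)` plus a drift over the period that is
  small in the relative scale (`|Z_{-j}(t) − Z_{-j}(0)| c^j ≤ A ρ^j`, `ρ < 1`) force
  `|Z_{-j}(t)| c^j ≤ |Z_0(0)| + A/(1−ρ) + A` for all `j ≥ 0`: the wake is geometric with ratio exactly
  `c⁻¹ = Λ/(1+T)` per shell;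
* `drift_le_of_box` — the drift from any all-time box by the mean value inequality (with
  `dyadRHS_bound`); for a weak geometric wake box `W θⁿ` the relative drift is `∝ (c/(Λθ²))^j`, summable as
  soon as `c < Λθ²`, i.e. `(1+T)·Λ < (1+Tmin)²`-type windows.

HONEST FRAMING: elementary bookkeeping about a MODEL lattice; no registered stub is closed, no summit
statement is touched.
-/

noncomputable section

set_option linter.dupNamespace false

namespace Summit.NavierStokesRegularity.NavierStokesRegularity.Theorems

namespace WakeRatchetLatticePeriod

open Set Filter Topology Finset

/-- **The relative periodicity propagates the sharp wake envelope down the wake.**  Let `Z` be any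
family with the matching `Z_{-j}(T) = c · Z_{-j-1}(0)` (`j ≥ 0`, `c > 0`) whose wake shells drift little
over the period in the RELATIVE scale `c^{-j}`: `|Z_{-j}(t) − Z_{-j}(0)| c^j ≤ A ρ^j` with `0 ≤ ρ < 1`.  Then
`|Z_{-j}(t)| c^j ≤ |Z_0(0)| + A/(1−ρ) + A` for all `j` and `t`: the wake IS geometric with ratio exactly
`c⁻¹` per shell, whatever weaker box it was found in.  (For a one-period witness of the dyadic lattice in a
weak geometric box `|Z_n| ≤ W θⁿ`, `n ≤ 1`, the drift hypothesis holds with `ρ = c/(Λθ²)` as soon as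
`c < Λθ²`, by the mean value inequality — `drift_le_of_box` below.)  This is what makes the sharp wake
envelope `P (s/Λ)ⁿ` of `scalarFront_of_latticePeriod` available at the REALISED flight time.
[elementary] -/
theorem wake_envelope_of_matching {c T Tmax A ρ : ℝ} {Z : ℤ → ℝ → ℝ} (hc : 0 < c)
    (hT : T ∈ Icc (0 : ℝ) Tmax) (hρ0 : 0 ≤ ρ) (hρ1 : ρ < 1)
    (hmatch : ∀ j : ℕ, Z (-(j : ℤ)) T = c * Z (-(j : ℤ) - 1) 0)
    (hdrift : ∀ j : ℕ, ∀ t ∈ Icc (0 : ℝ) Tmax, |Z (-(j : ℤ)) t - Z (-(j : ℤ)) 0| * c ^ j ≤ A * ρ ^ j) :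
    ∀ j : ℕ, ∀ t ∈ Icc (0 : ℝ) Tmax,
      |Z (-(j : ℤ)) t| * c ^ j ≤ |Z 0 0| + A / (1 - ρ) + A := by
  have hA : 0 ≤ A := by
    have h := hdrift 0 0 ⟨le_rfl, hT.1.trans hT.2⟩
    simp only [pow_zero, mul_one, sub_self, abs_zero] at h
    exact h
  -- geometric partial sums
  have hgeom : ∀ j : ℕ, ∑ i ∈ range j, ρ ^ i ≤ 1 / (1 - ρ) := by
    intro j
    have hs : Summable fun i : ℕ => ρ ^ i := summable_geometric_of_lt_one hρ0 hρ1
    have h1 := hs.sum_le_tsum (range j) (fun i _ => pow_nonneg hρ0 i)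
    rw [tsum_geometric_of_lt_one hρ0 hρ1] at h1
    simpa only [one_div] using h1
  -- the time-0 values: `Q_j = |Z_{-j}(0)| c^j ≤ |Z_0(0)| + A Σ_{i<j} ρ^i`
  have hQ : ∀ j : ℕ, |Z (-(j : ℤ)) 0| * c ^ j ≤ |Z 0 0| + A * ∑ i ∈ range j, ρ ^ i := by
    intro j
    induction j with
    | zero => simp
    | succ j ih =>
      have hm : Z (-((j + 1 : ℕ) : ℤ)) 0 = c⁻¹ * Z (-(j : ℤ)) T := by
        have := hmatch j
        rw [show (-(j : ℤ) - 1) = -((j + 1 : ℕ) : ℤ) by push_cast; ring] at this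
        rw [this, ← mul_assoc, inv_mul_cancel₀ hc.ne', one_mul]
      have hdr := hdrift j T hT
      have htri : |Z (-(j : ℤ)) T| ≤ |Z (-(j : ℤ)) 0| + |Z (-(j : ℤ)) T - Z (-(j : ℤ)) 0| := by
        have := abs_add_le (Z (-(j : ℤ)) 0) (Z (-(j : ℤ)) T - Z (-(j : ℤ)) 0)
        rwa [add_sub_cancel] at this
      rw [hm, abs_mul, abs_inv, abs_of_pos hc, pow_succ, Finset.sum_range_succ, mul_add]
      calc c⁻¹ * |Z (-(j : ℤ)) T| * (c ^ j * c) = |Z (-(j : ℤ)) T| * c ^ j * (c⁻¹ * c) := by ring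
        _ = |Z (-(j : ℤ)) T| * c ^ j := by rw [inv_mul_cancel₀ hc.ne', mul_one]
        _ ≤ (|Z (-(j : ℤ)) 0| + |Z (-(j : ℤ)) T - Z (-(j : ℤ)) 0|) * c ^ j :=
            mul_le_mul_of_nonneg_right htri (pow_nonneg hc.le j)
        _ = |Z (-(j : ℤ)) 0| * c ^ j + |Z (-(j : ℤ)) T - Z (-(j : ℤ)) 0| * c ^ j := by ring
        _ ≤ |Z 0 0| + (A * ∑ i ∈ range j, ρ ^ i + A * ρ ^ j) := by linarith [ih, hdr]
  intro j t ht
  have htri : |Z (-(j : ℤ)) t| ≤ |Z (-(j : ℤ)) 0| + |Z (-(j : ℤ)) t - Z (-(j : ℤ)) 0| := by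
    have := abs_add_le (Z (-(j : ℤ)) 0) (Z (-(j : ℤ)) t - Z (-(j : ℤ)) 0)
    rwa [add_sub_cancel] at this
  have hρj : A * ρ ^ j ≤ A := by
    have : ρ ^ j ≤ 1 := pow_le_one₀ hρ0 hρ1.le
    nlinarith
  calc |Z (-(j : ℤ)) t| * c ^ j
      ≤ (|Z (-(j : ℤ)) 0| + |Z (-(j : ℤ)) t - Z (-(j : ℤ)) 0|) * c ^ j :=
        mul_le_mul_of_nonneg_right htri (pow_nonneg hc.le j)
    _ = |Z (-(j : ℤ)) 0| * c ^ j + |Z (-(j : ℤ)) t - Z (-(j : ℤ)) 0| * c ^ j := by ring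
    _ ≤ (|Z 0 0| + A * ∑ i ∈ range j, ρ ^ i) + A * ρ ^ j := add_le_add (hQ j) (hdrift j t ht)
    _ ≤ |Z 0 0| + A * (1 / (1 - ρ)) + A := by
        have := mul_le_mul_of_nonneg_left (hgeom j) hA
        linarith
    _ = |Z 0 0| + A / (1 - ρ) + A := by ring

/-- **Drift over one period from a box (mean value inequality).**  A solution of the dyadic lattice on
`[0, Tmax]` staying in the box `|Z_n| ≤ b_n` moves each shell by at most
`(|Λ^{n-1}| b_{n-1}² + |Λ^n| b_n b_{n+1}) · t` up to time `t`.  For a geometric wake box `b_n = W θⁿ` and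
`t ≤ Tmax` this is `Tmax W² (Λ⁻¹θ⁻² + θ) (Λθ²)ⁿ`, i.e. the hypothesis of `wake_envelope_of_matching` with
`ρ = c/(Λθ²)` after multiplication by `c^{-n}` — summable down the wake as soon as `c < Λθ²`.
[elementary; uses `dyadRHS_bound`] -/
theorem drift_le_of_box {L Tmax : ℝ} {Z : ℤ → ℝ → ℝ} (b : ℤ → ℝ)
    (hD : ∀ n : ℤ, ∀ t ∈ Icc (0 : ℝ) Tmax, HasDerivWithinAt (Z n)
      (L ^ (n - 1) * Z (n - 1) t ^ 2 - L ^ n * Z n t * Z (n + 1) t) (Icc (0 : ℝ) Tmax) t)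
    (hb : ∀ n : ℤ, ∀ t ∈ Icc (0 : ℝ) Tmax, |Z n t| ≤ b n) (n : ℤ) :
    ∀ t ∈ Icc (0 : ℝ) Tmax,
      |Z n t - Z n 0| ≤ (|L ^ (n - 1)| * b (n - 1) ^ 2 + |L ^ n| * (b n * b (n + 1))) * t := by
  intro t ht
  have h := norm_image_sub_le_of_norm_deriv_le_segment' (f := Z n) (a := 0) (b := Tmax)
    (C := |L ^ (n - 1)| * b (n - 1) ^ 2 + |L ^ n| * (b n * b (n + 1)))
    (fun s hs => hD n s hs) (fun s hs => by
      rw [Real.norm_eq_abs]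
      exact dyadRHS_bound L b n (fun k => Z k s) fun k => hb k s (Ico_subset_Icc_self hs)) t ht
  rw [Real.norm_eq_abs, sub_zero] at h
  exact h

end WakeRatchetLatticePeriod

end Summit.NavierStokesRegularity.NavierStokesRegularity.Theorems

end
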